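import Literature.NumberTheory.EllipticCurves.Curve6137TwoIsogenyDescent
import HarnessLib

/-!
# The `2`-isogeny Selmer bounds of `Y = [0, -58, 0, -2184, 0] : y² = x(x + 26)(x − 84)`: `dim₂ S(-58,-2184) ≤ 4`, `dim₂ S'(-58,-2184) ≤ 0`
# (Silverman, AEC X.4.9, Example X.4.10: the congruence method)

Topic `NumberTheory/EllipticCurves`. File zero of the RANK-`2` ISOGENY-DOOR cell of route ShaPrimaryTransfer (seat bsd-line-spt-p1;
companions `Curve388SharpDescentY`, `Curve388IsogenyRank`, `Curve388SelmerCertificatesA`/`B`, `Curve388SelmerPointClasses`, `Curve388NontrivialSha`). `Y` is a model of the curve with full rational `2`-torsion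
`X' = [0, 776, 0, 147840, 0]` (`Y = ⟨2, -336, 0, 0⟩ • X'`). Here: the curves `Y`, `Y' = [0, 116, 0, 12100, 0]`, and the upper bounds
of the descent via the `2`-isogeny `Y → Y'`: `S'(-58, -2184) = S(116, 12100) ⊆ {1}` (every other squarefree divisor class
of `12100` dies modulo a prime power in both affine charts, tree lemma `Carrier6137.not_isSoluble_padic_twoIsogenyQuartic_of_zmodPow`), and
`dim₂ S(-58, -2184) ≤ ω(2184) + 1 = 4`. Theorems only; obstruction moduli found by a plain search (0 kit).

## References

* [SilvermanAEC2009] J. H. Silverman, *AEC*, 2nd ed.: Prop. X.4.9, Example X.4.10.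
-/

noncomputable section

open scoped Classical

namespace Literature.NumberTheory.EllipticCurves

namespace Curve388

open _root_.WeierstrassCurve _root_.WeierstrassCurve.Affine

/-! ## 0. The curves `Y`, `Y'` -/

/-- `b(a² − 4b) ≠ 0` for `Y = E_{-58,-2184}`. [cite: SilvermanAEC2009, Prop. X.4.9] -/
theorem habY : (-2184 : ℤ) * ((-58 : ℤ) ^ 2 - 4 * (-2184)) ≠ 0 := by norm_num

/-- The tree's literal `E_{-58,-2184}` is `Y`. [cite: SilvermanAEC2009, Prop. X.4.9] -/
theorem lit_Y : (⟨0, ((-58 : ℤ) : ℚ), 0, ((-2184 : ℤ) : ℚ), 0⟩ : WeierstrassCurve ℚ) = ⟨0, -58, 0, -2184, 0⟩ := by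
  ext <;> push_cast <;> ring

/-- The tree's literal `E_{−2a, a²−4b}` for `(a,b) = (-58,-2184)` is `Y' = [0, 116, 0, 12100, 0]`. [cite: SilvermanAEC2009, Prop. X.4.9] -/
theorem lit_Y' :
    (⟨0, ((-2 * (-58) : ℤ) : ℚ), 0, (((-58 : ℤ) ^ 2 - 4 * (-2184) : ℤ) : ℚ), 0⟩ : WeierstrassCurve ℚ) = ⟨0, 116, 0, 12100, 0⟩ := by
  ext <;> push_cast <;> ring

/-- The half-model literal for `(a,b) = (-58,-2184)`. [cite: SilvermanAEC2009, Prop. X.4.9] -/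
private theorem lit_V₀Y :
    (⟨0, -((-58 : ℤ) : ℚ) / 2, 0, (((-58 : ℤ) : ℚ) ^ 2 - 4 * (-2184 : ℤ)) / 16, 0⟩ : WeierstrassCurve ℚ) =
      ⟨0, 29, 0, (3025 / 4), 0⟩ := by
  ext <;> push_cast <;> ring

/-- `Y = [0, -58, 0, -2184, 0]` is an elliptic curve. [cite: SilvermanAEC2009, Prop. X.4.9] -/
theorem isElliptic_Y : (⟨0, -58, 0, -2184, 0⟩ : WeierstrassCurve ℚ).IsElliptic := by
  rw [← lit_Y]; exact isElliptic_mk_of_ne_zero (F := ℚ) habY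

/-- `Y' = [0, 116, 0, 12100, 0]` is an elliptic curve. [cite: SilvermanAEC2009, Prop. X.4.9] -/
theorem isElliptic_Y' : (⟨0, 116, 0, 12100, 0⟩ : WeierstrassCurve ℚ).IsElliptic := by
  rw [← lit_Y']; exact isElliptic_mk_of_ne_zero (F := ℚ) (twoIsogenyCodomain_ne_zero habY)

/-- The half-model of `Y'` is an elliptic curve. [cite: SilvermanAEC2009, Prop. X.4.9] -/
private theorem isElliptic_V₀Y : (⟨0, 29, 0, (3025 / 4), 0⟩ : WeierstrassCurve ℚ).IsElliptic := by
  rw [← lit_V₀Y]; exact isElliptic_halfModel habY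


/-! ## 1. The sharp descent on `Y = [0, -58, 0, -2184, 0]`: rank `2`, `Ш(Y/ℚ)[2] = 0`, `t_2(Y) = 0` -/

/-- `S(-58, -2184)` does not contain: `d = 2, -2, 3, -3, 7, -7, 42, -42, 13, -13, 78, -78, 182, -182, 273, -273` modulo `5` (no solution of either chart modulo the stated prime power; the sharp model).
[cite: SilvermanAEC2009, Example X.4.10 (the congruence method)] -/
theorem not_mem_S_Y :
    (2 : ℤ) ∉ twoIsogenySelmerGroup (-58) (-2184) ∧
      (-2 : ℤ) ∉ twoIsogenySelmerGroup (-58) (-2184) ∧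
      (3 : ℤ) ∉ twoIsogenySelmerGroup (-58) (-2184) ∧
      (-3 : ℤ) ∉ twoIsogenySelmerGroup (-58) (-2184) ∧
      (7 : ℤ) ∉ twoIsogenySelmerGroup (-58) (-2184) ∧
      (-7 : ℤ) ∉ twoIsogenySelmerGroup (-58) (-2184) ∧
      (42 : ℤ) ∉ twoIsogenySelmerGroup (-58) (-2184) ∧
      (-42 : ℤ) ∉ twoIsogenySelmerGroup (-58) (-2184) ∧
      (13 : ℤ) ∉ twoIsogenySelmerGroup (-58) (-2184) ∧
      (-13 : ℤ) ∉ twoIsogenySelmerGroup (-58) (-2184) ∧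
      (78 : ℤ) ∉ twoIsogenySelmerGroup (-58) (-2184) ∧
      (-78 : ℤ) ∉ twoIsogenySelmerGroup (-58) (-2184) ∧
      (182 : ℤ) ∉ twoIsogenySelmerGroup (-58) (-2184) ∧
      (-182 : ℤ) ∉ twoIsogenySelmerGroup (-58) (-2184) ∧
      (273 : ℤ) ∉ twoIsogenySelmerGroup (-58) (-2184) ∧
      (-273 : ℤ) ∉ twoIsogenySelmerGroup (-58) (-2184) := by
  have hB : (-2184 : ℤ) ≠ 0 := by norm_num
  haveI : Fact (Nat.Prime 5) := ⟨by norm_num⟩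
  refine ⟨?_, ?_, ?_, ?_, ?_, ?_, ?_, ?_, ?_, ?_, ?_, ?_, ?_, ?_, ?_, ?_⟩
  · refine Carrier6137.not_mem_twoIsogenySelmerGroup_of_not_isSoluble hB 5 ?_
    rw [show (-2184 : ℤ) / 2 = -1092 by norm_num]
    exact Carrier6137.not_isSoluble_padic_twoIsogenyQuartic_of_zmodPow 1 (by decide)
  · refine Carrier6137.not_mem_twoIsogenySelmerGroup_of_not_isSoluble hB 5 ?_
    rw [show (-2184 : ℤ) / -2 = 1092 by norm_num]
    exact Carrier6137.not_isSoluble_padic_twoIsogenyQuartic_of_zmodPow 1 (by decide)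
  · refine Carrier6137.not_mem_twoIsogenySelmerGroup_of_not_isSoluble hB 5 ?_
    rw [show (-2184 : ℤ) / 3 = -728 by norm_num]
    exact Carrier6137.not_isSoluble_padic_twoIsogenyQuartic_of_zmodPow 1 (by decide)
  · refine Carrier6137.not_mem_twoIsogenySelmerGroup_of_not_isSoluble hB 5 ?_
    rw [show (-2184 : ℤ) / -3 = 728 by norm_num]
    exact Carrier6137.not_isSoluble_padic_twoIsogenyQuartic_of_zmodPow 1 (by decide)
  · refine Carrier6137.not_mem_twoIsogenySelmerGroup_of_not_isSoluble hB 5 ?_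
    rw [show (-2184 : ℤ) / 7 = -312 by norm_num]
    exact Carrier6137.not_isSoluble_padic_twoIsogenyQuartic_of_zmodPow 1 (by decide)
  · refine Carrier6137.not_mem_twoIsogenySelmerGroup_of_not_isSoluble hB 5 ?_
    rw [show (-2184 : ℤ) / -7 = 312 by norm_num]
    exact Carrier6137.not_isSoluble_padic_twoIsogenyQuartic_of_zmodPow 1 (by decide)
  · refine Carrier6137.not_mem_twoIsogenySelmerGroup_of_not_isSoluble hB 5 ?_
    rw [show (-2184 : ℤ) / 42 = -52 by norm_num]
    exact Carrier6137.not_isSoluble_padic_twoIsogenyQuartic_of_zmodPow 1 (by decide)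
  · refine Carrier6137.not_mem_twoIsogenySelmerGroup_of_not_isSoluble hB 5 ?_
    rw [show (-2184 : ℤ) / -42 = 52 by norm_num]
    exact Carrier6137.not_isSoluble_padic_twoIsogenyQuartic_of_zmodPow 1 (by decide)
  · refine Carrier6137.not_mem_twoIsogenySelmerGroup_of_not_isSoluble hB 5 ?_
    rw [show (-2184 : ℤ) / 13 = -168 by norm_num]
    exact Carrier6137.not_isSoluble_padic_twoIsogenyQuartic_of_zmodPow 1 (by decide)
  · refine Carrier6137.not_mem_twoIsogenySelmerGroup_of_not_isSoluble hB 5 ?_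
    rw [show (-2184 : ℤ) / -13 = 168 by norm_num]
    exact Carrier6137.not_isSoluble_padic_twoIsogenyQuartic_of_zmodPow 1 (by decide)
  · refine Carrier6137.not_mem_twoIsogenySelmerGroup_of_not_isSoluble hB 5 ?_
    rw [show (-2184 : ℤ) / 78 = -28 by norm_num]
    exact Carrier6137.not_isSoluble_padic_twoIsogenyQuartic_of_zmodPow 1 (by decide)
  · refine Carrier6137.not_mem_twoIsogenySelmerGroup_of_not_isSoluble hB 5 ?_
    rw [show (-2184 : ℤ) / -78 = 28 by norm_num]
    exact Carrier6137.not_isSoluble_padic_twoIsogenyQuartic_of_zmodPow 1 (by decide)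
  · refine Carrier6137.not_mem_twoIsogenySelmerGroup_of_not_isSoluble hB 5 ?_
    rw [show (-2184 : ℤ) / 182 = -12 by norm_num]
    exact Carrier6137.not_isSoluble_padic_twoIsogenyQuartic_of_zmodPow 1 (by decide)
  · refine Carrier6137.not_mem_twoIsogenySelmerGroup_of_not_isSoluble hB 5 ?_
    rw [show (-2184 : ℤ) / -182 = 12 by norm_num]
    exact Carrier6137.not_isSoluble_padic_twoIsogenyQuartic_of_zmodPow 1 (by decide)
  · refine Carrier6137.not_mem_twoIsogenySelmerGroup_of_not_isSoluble hB 5 ?_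
    rw [show (-2184 : ℤ) / 273 = -8 by norm_num]
    exact Carrier6137.not_isSoluble_padic_twoIsogenyQuartic_of_zmodPow 1 (by decide)
  · refine Carrier6137.not_mem_twoIsogenySelmerGroup_of_not_isSoluble hB 5 ?_
    rw [show (-2184 : ℤ) / -273 = 8 by norm_num]
    exact Carrier6137.not_isSoluble_padic_twoIsogenyQuartic_of_zmodPow 1 (by decide)

/-- A squarefree integer dividing `-2184` is `±` a divisor of `546`. [cite: SilvermanAEC2009, Prop. X.4.9] -/
private theorem mem_of_dvd_bY {d : ℤ} (hsq : Squarefree d) (hd : d ∣ (-2184 : ℤ)) :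
    d ∈ ({1, -1, 2, -2, 3, -3, 6, -6, 7, -7, 13, -13, 14, -14, 21, -21, 26, -26, 39, -39, 42, -42, 78, -78, 91, -91, 182, -182, 273, -273, 546, -546} : Finset ℤ) := by
  have hrad : d ∣ 546 := by
    have h5 : d ∣ (546 : ℤ) ^ 3 := dvd_trans hd ⟨-74529, by norm_num⟩
    exact (hsq.dvd_pow_iff_dvd (by norm_num)).mp h5
  have h1 : d.natAbs ∣ 546 := by
    have := Int.natAbs_dvd_natAbs.mpr hrad
    simpa using this
  have h2 : d.natAbs ∈ Nat.divisors 546 := Nat.mem_divisors.mpr ⟨h1, by norm_num⟩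
  rw [show Nat.divisors 546 = {1, 2, 3, 6, 7, 13, 14, 21, 26, 39, 42, 78, 91, 182, 273, 546} by decide +kernel] at h2
  simp only [Finset.mem_insert, Finset.mem_singleton] at h2 ⊢
  rcases Int.natAbs_eq d with h | h <;> rw [h] <;>
    rcases h2 with h2 | h2 | h2 | h2 | h2 | h2 | h2 | h2 | h2 | h2 | h2 | h2 | h2 | h2 | h2 | h2 <;> simp [h2]

/-- **`S(-58, -2184) ⊆ {1, -1, 6, -6, 14, -14, 21, -21, 26, -26, 39, -39, 91, -91, 546, -546}`**. [cite: SilvermanAEC2009, Prop. X.4.9 and Example X.4.10] -/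
theorem twoIsogenySelmerGroup_Y_subset :
    twoIsogenySelmerGroup (-58) (-2184) ⊆ ({1, -1, 6, -6, 14, -14, 21, -21, 26, -26, 39, -39, 91, -91, 546, -546} : Finset ℤ) := by
  intro d hd
  obtain ⟨hsq, hdvd, -⟩ := (mem_twoIsogenySelmerGroup_iff (a := -58) (by norm_num : (-2184 : ℤ) ≠ 0)).mp hd
  have hmem := mem_of_dvd_bY hsq hdvd
  obtain ⟨h2, hm2, h3, hm3, h7, hm7, h42, hm42, h13, hm13, h78, hm78, h182, hm182, h273, hm273⟩ := not_mem_S_Y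
  simp only [Finset.mem_insert, Finset.mem_singleton] at hmem ⊢
  rcases hmem with rfl | rfl | rfl | rfl | rfl | rfl | rfl | rfl | rfl | rfl | rfl | rfl | rfl | rfl | rfl | rfl | rfl | rfl | rfl | rfl | rfl | rfl | rfl | rfl | rfl | rfl | rfl | rfl | rfl | rfl | rfl | rfl
  · simp
  · simp
  · exact absurd hd h2
  · exact absurd hd hm2
  · exact absurd hd h3
  · exact absurd hd hm3
  · simp
  · simp
  · exact absurd hd h7
  · exact absurd hd hm7
  · exact absurd hd h13
  · exact absurd hd hm13
  · simp
  · simp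
  · simp
  · simp
  · simp
  · simp
  · simp
  · simp
  · exact absurd hd h42
  · exact absurd hd hm42
  · exact absurd hd h78
  · exact absurd hd hm78
  · simp
  · simp
  · exact absurd hd h182
  · exact absurd hd hm182
  · exact absurd hd h273
  · exact absurd hd hm273
  · simp
  · simp

/-- `S(116, 12100)` does not contain: `d = -1, 2, 5, -10, 11, -22, -55, 110` modulo `9`; `d = -5, 10, 55, -110` modulo `16`; `d = -11` modulo `32`; `d = -2` modulo `49`; `d = 22` modulo `64` (no solution of either chart modulo the stated prime power; the sharp model, other side).
[cite: SilvermanAEC2009, Example X.4.10 (the congruence method)] -/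
theorem not_mem_S'_Y :
    (-1 : ℤ) ∉ twoIsogenySelmerGroup (116) (12100) ∧
      (2 : ℤ) ∉ twoIsogenySelmerGroup (116) (12100) ∧
      (-2 : ℤ) ∉ twoIsogenySelmerGroup (116) (12100) ∧
      (5 : ℤ) ∉ twoIsogenySelmerGroup (116) (12100) ∧
      (-5 : ℤ) ∉ twoIsogenySelmerGroup (116) (12100) ∧
      (10 : ℤ) ∉ twoIsogenySelmerGroup (116) (12100) ∧
      (-10 : ℤ) ∉ twoIsogenySelmerGroup (116) (12100) ∧
      (11 : ℤ) ∉ twoIsogenySelmerGroup (116) (12100) ∧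
      (-11 : ℤ) ∉ twoIsogenySelmerGroup (116) (12100) ∧
      (22 : ℤ) ∉ twoIsogenySelmerGroup (116) (12100) ∧
      (-22 : ℤ) ∉ twoIsogenySelmerGroup (116) (12100) ∧
      (55 : ℤ) ∉ twoIsogenySelmerGroup (116) (12100) ∧
      (-55 : ℤ) ∉ twoIsogenySelmerGroup (116) (12100) ∧
      (110 : ℤ) ∉ twoIsogenySelmerGroup (116) (12100) ∧
      (-110 : ℤ) ∉ twoIsogenySelmerGroup (116) (12100) := by
  have hB : (12100 : ℤ) ≠ 0 := by norm_num
  haveI : Fact (Nat.Prime 2) := ⟨by norm_num⟩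
  haveI : Fact (Nat.Prime 3) := ⟨by norm_num⟩
  haveI : Fact (Nat.Prime 7) := ⟨by norm_num⟩
  refine ⟨?_, ?_, ?_, ?_, ?_, ?_, ?_, ?_, ?_, ?_, ?_, ?_, ?_, ?_, ?_⟩
  · refine Carrier6137.not_mem_twoIsogenySelmerGroup_of_not_isSoluble hB 3 ?_
    rw [show (12100 : ℤ) / -1 = -12100 by norm_num]
    exact Carrier6137.not_isSoluble_padic_twoIsogenyQuartic_of_zmodPow 2 (by decide)
  · refine Carrier6137.not_mem_twoIsogenySelmerGroup_of_not_isSoluble hB 3 ?_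
    rw [show (12100 : ℤ) / 2 = 6050 by norm_num]
    exact Carrier6137.not_isSoluble_padic_twoIsogenyQuartic_of_zmodPow 2 (by decide)
  · refine Carrier6137.not_mem_twoIsogenySelmerGroup_of_not_isSoluble hB 7 ?_
    rw [show (12100 : ℤ) / -2 = -6050 by norm_num]
    exact Carrier6137.not_isSoluble_padic_twoIsogenyQuartic_of_zmodPow 2 (by decide +kernel)
  · refine Carrier6137.not_mem_twoIsogenySelmerGroup_of_not_isSoluble hB 3 ?_
    rw [show (12100 : ℤ) / 5 = 2420 by norm_num]
    exact Carrier6137.not_isSoluble_padic_twoIsogenyQuartic_of_zmodPow 2 (by decide)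
  · refine Carrier6137.not_mem_twoIsogenySelmerGroup_of_not_isSoluble hB 2 ?_
    rw [show (12100 : ℤ) / -5 = -2420 by norm_num]
    exact Carrier6137.not_isSoluble_padic_twoIsogenyQuartic_of_zmodPow 4 (by decide)
  · refine Carrier6137.not_mem_twoIsogenySelmerGroup_of_not_isSoluble hB 2 ?_
    rw [show (12100 : ℤ) / 10 = 1210 by norm_num]
    exact Carrier6137.not_isSoluble_padic_twoIsogenyQuartic_of_zmodPow 4 (by decide)
  · refine Carrier6137.not_mem_twoIsogenySelmerGroup_of_not_isSoluble hB 3 ?_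
    rw [show (12100 : ℤ) / -10 = -1210 by norm_num]
    exact Carrier6137.not_isSoluble_padic_twoIsogenyQuartic_of_zmodPow 2 (by decide)
  · refine Carrier6137.not_mem_twoIsogenySelmerGroup_of_not_isSoluble hB 3 ?_
    rw [show (12100 : ℤ) / 11 = 1100 by norm_num]
    exact Carrier6137.not_isSoluble_padic_twoIsogenyQuartic_of_zmodPow 2 (by decide)
  · refine Carrier6137.not_mem_twoIsogenySelmerGroup_of_not_isSoluble hB 2 ?_
    rw [show (12100 : ℤ) / -11 = -1100 by norm_num]
    exact Carrier6137.not_isSoluble_padic_twoIsogenyQuartic_of_zmodPow 5 (by decide)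
  · refine Carrier6137.not_mem_twoIsogenySelmerGroup_of_not_isSoluble hB 2 ?_
    rw [show (12100 : ℤ) / 22 = 550 by norm_num]
    exact Carrier6137.not_isSoluble_padic_twoIsogenyQuartic_of_zmodPow 6 (by decide +kernel)
  · refine Carrier6137.not_mem_twoIsogenySelmerGroup_of_not_isSoluble hB 3 ?_
    rw [show (12100 : ℤ) / -22 = -550 by norm_num]
    exact Carrier6137.not_isSoluble_padic_twoIsogenyQuartic_of_zmodPow 2 (by decide)
  · refine Carrier6137.not_mem_twoIsogenySelmerGroup_of_not_isSoluble hB 2 ?_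
    rw [show (12100 : ℤ) / 55 = 220 by norm_num]
    exact Carrier6137.not_isSoluble_padic_twoIsogenyQuartic_of_zmodPow 4 (by decide)
  · refine Carrier6137.not_mem_twoIsogenySelmerGroup_of_not_isSoluble hB 3 ?_
    rw [show (12100 : ℤ) / -55 = -220 by norm_num]
    exact Carrier6137.not_isSoluble_padic_twoIsogenyQuartic_of_zmodPow 2 (by decide)
  · refine Carrier6137.not_mem_twoIsogenySelmerGroup_of_not_isSoluble hB 3 ?_
    rw [show (12100 : ℤ) / 110 = 110 by norm_num]
    exact Carrier6137.not_isSoluble_padic_twoIsogenyQuartic_of_zmodPow 2 (by decide)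
  · refine Carrier6137.not_mem_twoIsogenySelmerGroup_of_not_isSoluble hB 2 ?_
    rw [show (12100 : ℤ) / -110 = -110 by norm_num]
    exact Carrier6137.not_isSoluble_padic_twoIsogenyQuartic_of_zmodPow 4 (by decide)

/-- A squarefree integer dividing `12100` is `±` a divisor of `110`. [cite: SilvermanAEC2009, Prop. X.4.9] -/
private theorem mem_of_dvd_bY' {d : ℤ} (hsq : Squarefree d) (hd : d ∣ (12100 : ℤ)) :
    d ∈ ({1, -1, 2, -2, 5, -5, 10, -10, 11, -11, 22, -22, 55, -55, 110, -110} : Finset ℤ) := by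
  have hrad : d ∣ 110 := by
    have h5 : d ∣ (110 : ℤ) ^ 2 := dvd_trans hd ⟨1, by norm_num⟩
    exact (hsq.dvd_pow_iff_dvd (by norm_num)).mp h5
  have h1 : d.natAbs ∣ 110 := by
    have := Int.natAbs_dvd_natAbs.mpr hrad
    simpa using this
  have h2 : d.natAbs ∈ Nat.divisors 110 := Nat.mem_divisors.mpr ⟨h1, by norm_num⟩
  rw [show Nat.divisors 110 = {1, 2, 5, 10, 11, 22, 55, 110} by decide +kernel] at h2
  simp only [Finset.mem_insert, Finset.mem_singleton] at h2 ⊢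
  rcases Int.natAbs_eq d with h | h <;> rw [h] <;>
    rcases h2 with h2 | h2 | h2 | h2 | h2 | h2 | h2 | h2 <;> simp [h2]

/-- **`S(116, 12100) ⊆ {1}`**. [cite: SilvermanAEC2009, Prop. X.4.9 and Example X.4.10] -/
theorem twoIsogenySelmerGroup'_Y_subset :
    twoIsogenySelmerGroup (116) (12100) ⊆ ({1} : Finset ℤ) := by
  intro d hd
  obtain ⟨hsq, hdvd, -⟩ := (mem_twoIsogenySelmerGroup_iff (a := 116) (by norm_num : (12100 : ℤ) ≠ 0)).mp hd
  have hmem := mem_of_dvd_bY' hsq hdvd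
  obtain ⟨hm1, h2, hm2, h5, hm5, h10, hm10, h11, hm11, h22, hm22, h55, hm55, h110, hm110⟩ := not_mem_S'_Y
  simp only [Finset.mem_insert, Finset.mem_singleton] at hmem ⊢
  rcases hmem with rfl | rfl | rfl | rfl | rfl | rfl | rfl | rfl | rfl | rfl | rfl | rfl | rfl | rfl | rfl | rfl
  · simp
  · exact absurd hd hm1
  · exact absurd hd h2
  · exact absurd hd hm2
  · exact absurd hd h5
  · exact absurd hd hm5
  · exact absurd hd h10
  · exact absurd hd hm10
  · exact absurd hd h11
  · exact absurd hd hm11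
  · exact absurd hd h22
  · exact absurd hd hm22
  · exact absurd hd h55
  · exact absurd hd hm55
  · exact absurd hd h110
  · exact absurd hd hm110

/-- `2^k ≤ 2^n` forces `k ≤ n`. [cite: SilvermanAEC2009, Prop. X.4.9] -/
private theorem le_of_two_pow_le {k n : ℕ} (h : 2 ^ k ≤ 2 ^ n) : k ≤ n :=
  (Nat.pow_le_pow_iff_right (by norm_num)).mp h

/-- **`dim₂ S(-58,-2184) ≤ 4` and `dim₂ S'(-58,-2184) ≤ 0`.** [cite: SilvermanAEC2009, Prop. X.4.9] -/
theorem twoIsogenySelmerRank_Y_add_le :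
    twoIsogenySelmerRank (-58) (-2184) ≤ 4 ∧ twoIsogenySelmerRank' (-58) (-2184) ≤ 0 := by
  constructor
  · apply le_of_two_pow_le
    rw [two_pow_twoIsogenySelmerRank_eq_card habY]
    exact (Finset.card_le_card twoIsogenySelmerGroup_Y_subset).trans (by decide)
  · apply le_of_two_pow_le
    rw [two_pow_twoIsogenySelmerRank'_eq_card habY, twoIsogenySelmerGroup'_eq,
      show (-2 * (-58) : ℤ) = 116 by norm_num, show ((-58 : ℤ) ^ 2 - 4 * (-2184) : ℤ) = 12100 by norm_num]
    exact (Finset.card_le_card twoIsogenySelmerGroup'_Y_subset).trans (by decide)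


end Curve388

end Literature.NumberTheory.EllipticCurves

end
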